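import Literature.MathematicalPhysics.QuantumFieldTheory.King1986.CovarianceQstar
import HarnessLib

/-!
# King 1986, (2.17): the scale decomposition `G^ε_{k+1} = G^ε_k + a_k²G^ε_kQ_k^*·C^{(k)}·Q_kG^ε_k` of the
# block-constrained propagator — the operator-level composition law of the block-spin Gaussian, PROVED as
# an exact matrix identity on the torus

**Citation header (reproduction of PUBLISHED work whose proof the source omits; seat `pub-ymgap-dag-n15-e`
(generation 5) of the cell `pub-ymgap`, Track-A node N15 = NE2, King-model rung; companion of
`King1986/EffectiveLaplacianSymbol` (the one-level objects `Q`, `A₀`, `Δ_eff`, the minimiser) and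
`King1986/CovarianceQstar` ((4.44)); the symbol-level composition law is `King1986/CompositionLaw`.)**
C. King, *The U(1) Higgs model. I. The continuum limit*, Commun. Math. Phys. **102** (1986) 649–677 [King1986],
§2.2 p. 653 (2.13)–(2.17), p. 654 (2.18)–(2.20); §4 p. 675 (4.42).  Page image READ AS IMAGE by this seat:
`pub-balaban/b2b-balaban-template/king-renders/1986-cmp102-king-u1-higgs-I-p005-x2.png` (p. 653).  King's paper
is TEMPLATE LITERATURE (a printed `A = 0`-capable mechanism); nothing here is about Bałaban's covariant objects.

**What King prints (verbatim, p. 653).**  «The covariance of the scalar fluctuation field over blocks of size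
L^kε on Ω is  G^ε_k(Ω, A) = (−Δ^{ε,Ω}_A + m² + a_k(L^kε)^{−2}Q_k(A)^*Q_k(A))^{−1}, (2.13)  where a_k = a(1 − L^{−2})
(1 − L^{−2k})^{−1} and a is O(1). The effective Laplacian of the average scalar field on Ω^{(k)} is
Δ^{(k),L^kε}(Ω, A) = a_k(L^kε)^{−2}I − a_k²(L^kε)^{−4}Q_k(A)G^ε_k(Ω, A)Q_k(A)^*. (2.14) … The covariance of the
scalar fluctuation field over blocks of size L^d on Ω^{(k)} is  C^{(k),L^kε}(Ω, A) = (Δ^{(k),L^kε}(Ω, A) +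
a(L^{k+1}ε)^{−2}Q(A)^*Q(A))^{−1}, (2.16)  where C^{(0),ε}(Ω, A) = G^ε_1(Ω, A). The operator (2.13) can be decomposed
into a sum of contributions from scales between Ω and Ω^{(k)}:  G^ε_k(Ω, A) = C^{(0),ε}(Ω, A) + Σ_{j=1}^{k−1}
a_j²(L^jε)^{−4}G^ε_j(Ω, A)Q_j(A)^*·C^{(j),L^jε}(Ω, A)Q_j(A)G^ε_j(Ω, A) ≡ Σ_{j=0}^{k−1} G^ε_{(j)}(Ω, A), (2.17)  with the
obvious definition of G^ε_{(j)}(Ω, A).»  (p. 675, (4.42): «For j > 0, we have the expansion G^{η′}_{(j)}(x′, y′) =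
a²_{j+n}(L^jη)^{−4} Σ_{z,w∈L^jηZ^d} (L^jη)^{2d}G^{η′}_{j+n}Q*_{j+n}(x′, z)·C^{(j+n),L^jη}(z, w)Q_{j+n}G^{η′}_{j+n}(w, y′)».)
King STATES (2.17) without proof (it is the composition law `T_{a,L}∘T_{a_k,L^k} = T_{a_{k+1},L^{k+1}}` of the
block-spin transformations read on covariances); this file supplies the proof of its one-step form
`G^ε_{k+1} − G^ε_k = a_k²G^ε_kQ_k^*·C^{(k)}·Q_kG^ε_k`, of which (2.17) is the telescoped sum over `j = 1, …, k − 1`.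

**Conventions (those of `EffectiveLaplacianSymbol`, level-`k` units `L^kε = 1`, `η = N⁻¹`, `N = L^k`).**  `B = c(−Δ) + m²`
(`lapF`), `Q = Qmat N M′` the block MEAN, `Q*Q = blockProj N M′ = N^dQᵀQ`, `A₀ = B + a_k·Q*Q` (`fineOp`), `G^ε_k ≙ N^d·A₀⁻¹`
(the covariance MATRIX of the fluctuation field; `CovarianceQstar`: «`G^η_K = N^dA₀⁻¹`»), `ℋ_k = a_kG^ε_kQ_k^* ≙
(a_kN^d)·A₀⁻¹Qᵀ` (`minimiser`), `Δ^{(k)} = a_k − a_k²N^d·QA₀⁻¹Qᵀ` (`effLaplacian`).  TWO LEVELS AT ONCE: the block lattice is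
itself blocked, `M′ = fine L M` — fine torus = the NESTED torus `Tor (fine N (fine L M))`, level-`k` lattice `Tor (fine L M)`
(carrier of `C^{(k)} = (Δ^{(k)} + aL⁻²·blockProj L M)⁻¹`, the body of the cell's `N15.KingModel.kingCov`), level `k+1` = `Tor M`.

**What this file PROVES (kernel; no hypothesis beyond `a, a_k > 0`, `c ≥ 0`, `m² > 0`).**
* §1 `Qmat_mul_transpose_Qmat`: `QQᵀ = N^{−d}·1` (each block has `N^d` sites of weight `N^{−d}`; King's `Q_kQ_k^* = 1`);
  the objects `minimiserMat = (a_kN^d)·A₀⁻¹Qᵀ` (`minimiser … φ = minimiserMat *ᵥ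
  φ`; `minimiserMat x b = minimiser … (Pi.single b 1) x` = the kernel `ℋ_k(x, b)` the cell's files use), `constrainedProp =
  N^d·A₀⁻¹` (`G^ε_k`); §2 the composite mean `Qmat₂ = Qmat L M ⬝ Qmat N (fine L M)` (`Q_{k+1}` on the nested torus) and
  projector `blockProj₂ = (NL)^d·Qmat₂ᵀQmat₂` (`Q_{k+1}^*Q_{k+1}`), `oneStepCov = (Δ^{(k)} + aL⁻²Q*Q)⁻¹` ((2.16)),
  `nextLevelCoeff a a_k L = a·a_k∕(a + a_kL²)` with **`nextLevelCoeff_aK`** (`= aK a L (k+1)∕L²` = King's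
  `a_{k+1}(L^{k+1}ε)^{−2}` in level-`k` units, by `inv_aK_add`), and `constrainedProp₂ = N^d·(B + nextLevelCoeff·blockProj₂)⁻¹`
  (`G^ε_{k+1}`: (2.13) at `k + 1`, in level-`k` units via (2.20)).
* §3 `effLaplacian_coercive_of_nonneg` (`Δ^{(k)} ≥ (a_k⁻¹ + m⁻²)⁻¹` for EVERY `c ≥ 0`, variationally from
  `effLaplacian_eq_energy` and `|Qψ|² ≤ N^{−d}|ψ|²`; `CovarianceQstar.effLaplacian_coercive` has `c = N²` via the symbol),
  `isUnit_effLaplacian_add_blockProj`, and THE THEOREM **`constrainedProp₂_eq`**: `constrainedProp₂ = constrainedProp +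
  minimiserMat ⬝ oneStepCov ⬝ minimiserMatᵀ`, i.e. **`G^ε_{k+1} = G^ε_k + ℋ_kC^{(k)}ℋ_kᵀ = G^ε_k + a_k²G^ε_kQ_k^*·C^{(k)}·Q_kG^ε_k`**
  — (2.17) one step.  PROOF (law of total covariance of the two-step block-spin Gaussian ≡ the two Schur-complement
  readings of one block inverse; here bare algebra): `B + b·Q_{k+1}^*Q_{k+1} = A₀ + QᵀRQ`, `R = b(NL)^d·qᵀq − a_kN^d`
  (`q = Qmat L M`); the candidate inverse `A₀⁻¹ + a_k²N^d·A₀⁻¹QᵀCQA₀⁻¹` works iff `R + a_k²N^d(1 + R·QA₀⁻¹Qᵀ)C = 0`, which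
  after (2.14) and `qqᵀ = L^{−d}` is the scalar identity `a_kbL² = a(a_k − b)`, i.e. `b⁻¹ = a_k⁻¹ + L²a⁻¹`.
* §4 the KERNEL FORM **`constrainedProp₂_sub_apply`** ∕ `…_minimiser` ∕ `constrainedProp₂_sub_eq`: `G^ε_{k+1}(x, y) −
  G^ε_k(x, y) = Σ_w (Σ_z ℋ_k(x, z)·C^{(k)}(z, w))·ℋ_k(y, w)` — (4.42) ∕ «the obvious definition of G^ε_{(j)}» as a theorem.

**NOT COVERED.**  The flat re-indexing `Tor (fine N (fine L M)) ≃ Tor (fine (N·L) M)` (`blockProj₂ ↦ blockProj (N·L) M`)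
and the (2.20) change to level-`(k+1)` units (bookkeeping; sequel); the telescoped sum (2.17) itself (immediate from
the one-step form once all levels sit on one torus); free boundary conditions; `A ≠ 0`; the vector field.  HONEST FRAMING:
King's scalar block-spin MODEL on a finite torus — exact finite-dimensional linear algebra; nothing about Bałaban's
covariant objects; nothing continuum ∕ mass-gap ∕ Clay; count-neutral for the cell's 27 nodes.
-/

noncomputable section

open Finset Real Matrix
open scoped BigOperators

namespace Literature.MathematicalPhysics.QuantumFieldTheory.King1986

open Literature.MathematicalPhysics.QuantumFieldTheory.Balaban1983to89
open Literature.MathematicalPhysics.QuantumFieldTheory.Balaban1983to89.B5Prop11Plancherel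

namespace Torus

variable {d : ℕ}

/-! ## §1 One level: `QQᵀ = N^{−d}`, the minimiser as a matrix, `G^ε_k`, coercivity of `Δ^{(k)}` for every `c ≥ 0` -/

section OneLevel

variable (N : ℕ) [NeZero N] (M : Fin d → ℕ) [hM : ∀ μ, NeZero (M μ)]

/-- **`QQᵀ = N^{−d}·1`**: the rows of the block mean have disjoint supports (the blocks), each of `N^d` sites carrying
the weight `N^{−d}` — King's `Q_kQ_k^* = 1` in the `η`-weighted convention (`Q^* = N^dQᵀ`).
[cite: King1986, (2.10) p.653; BFKT2016Bloch, Lemma 9(a)] -/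
theorem Qmat_mul_transpose_Qmat :
    Qmat N M * (Qmat N M)ᵀ = (((N : ℝ) ^ d)⁻¹) • (1 : Matrix (Tor M) (Tor M) ℝ) := by
  ext b b'
  rw [Matrix.mul_apply, Matrix.smul_apply, Matrix.one_apply, smul_eq_mul]
  rw [← (blockEquiv N M).sum_comp]
  simp only [Fintype.sum_prod_type, blockEquiv_apply, Matrix.transpose_apply, Qmat, blockOf_site]
  have hNd : ((N : ℝ) ^ d) ≠ 0 := pow_ne_zero _ (by exact_mod_cast NeZero.ne N)
  rw [Finset.sum_eq_single b]
  · simp only [if_true]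
    rw [Finset.sum_const, Finset.card_univ, Fintype.card_fun, Fintype.card_fin, Fintype.card_fin, nsmul_eq_mul]
    push_cast
    split_ifs
    · rw [mul_one, ← mul_assoc, mul_inv_cancel₀ hNd, one_mul]
    · simp
  · intro b'' _ hb''
    rw [if_neg hb'']
    simp
  · intro h; exact absurd (Finset.mem_univ _) h

/-- THE MINIMISER AS A MATRIX: `ℋ = (aN^d)·A₀⁻¹Qᵀ` — King's `a_kG^ε_kQ_k^*` in the tree's unweighted conventions, exactly
the linear map `φ ↦ minimiser … φ` (`minimiser_eq_minimiserMat_mulVec`). [cite: King1986, (2.13)–(2.15) p.653, (2.18) p.654] -/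
def minimiserMat (a c m2 : ℝ) : Matrix (Tor (fine N M)) (Tor M) ℝ :=
  (a * (N : ℝ) ^ d) • ((fineOp N M a c m2)⁻¹ * (Qmat N M)ᵀ)

/-- `minimiser φ = ℋ *ᵥ φ`. [cite: King1986, (2.15) p.653] -/
theorem minimiser_eq_minimiserMat_mulVec (a c m2 : ℝ) (φ : Tor M → ℝ) :
    minimiser N M a c m2 φ = minimiserMat N M a c m2 *ᵥ φ := by
  rw [minimiser, minimiserMat, Matrix.smul_mulVec, Matrix.mulVec_mulVec]

/-- The matrix entries ARE the minimiser kernel the cell's files use: `ℋ(x, b) = minimiser … (δ_b)(x)`.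
[cite: King1986, (2.15) p.653] -/
theorem minimiserMat_apply (a c m2 : ℝ) (x : Tor (fine N M)) (b : Tor M) :
    minimiserMat N M a c m2 x b = minimiser N M a c m2 (Pi.single b 1) x := by
  rw [minimiser_eq_minimiserMat_mulVec, Matrix.mulVec_single_one]
  rfl

/-- `ℋᵀ = (aN^d)·QA₀⁻¹` = King's `a_kQ_kG^ε_k` (`A₀` is symmetric). [cite: King1986, (2.14)–(2.15) p.653] -/
theorem transpose_minimiserMat (a c m2 : ℝ) :
    (minimiserMat N M a c m2)ᵀ = (a * (N : ℝ) ^ d) • (Qmat N M * (fineOp N M a c m2)⁻¹) := by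
  rw [minimiserMat, Matrix.transpose_smul, Matrix.transpose_mul, Matrix.transpose_transpose,
    Matrix.transpose_nonsing_inv, fineOp_transpose]

/-- THE BLOCK-CONSTRAINED PROPAGATOR `G^ε_k ≙ N^d·A₀⁻¹` — the covariance matrix of the fluctuation field of (2.13)
in level-`k` units (the precision of `exp(−½[η^dΣψ(c(−Δ)+m²)ψ + a_k|Q_kψ|²])` is `N^{−d}A₀`).
[cite: King1986, (2.13) p.653, (4.44) p.675] -/
def constrainedProp (a c m2 : ℝ) : Matrix (Tor (fine N M)) (Tor (fine N M)) ℝ :=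
  ((N : ℝ) ^ d) • (fineOp N M a c m2)⁻¹

/-- **`Δ^{(k)} ≥ (a⁻¹ + m⁻²)⁻¹` for EVERY `c ≥ 0`** (variational route: `⟨φ,Δ_effφ⟩ = a|φ − Qψ_φ|² + N^{−d}⟨ψ_φ, Bψ_φ⟩ ≥
a|φ − u|² + m²|u|²`, `u = Qψ_φ`, `|Qψ|² ≤ N^{−d}|ψ|²`, and `a|φ − u|² + m²|u|² ≥ (a⁻¹ + m⁻²)⁻¹|φ|²`).
[cite: King1986, (2.14) p.653, (4.33) p.674] -/
theorem effLaplacian_coercive_of_nonneg {a c m2 : ℝ} (ha : 0 < a) (hc : 0 ≤ c) (hm : 0 < m2) :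
    QGQInverse.Coercive (effLaplacian N M a c m2) ((a⁻¹ + m2⁻¹)⁻¹) := by
  intro φ
  have hNd : (0 : ℝ) < (N : ℝ) ^ d := pow_pos (by exact_mod_cast Nat.pos_of_ne_zero (NeZero.ne N)) _
  rw [effLaplacian_eq_energy N M ha.le hc hm, energy]
  set ψ := minimiser N M a c m2 φ with hψ
  set u := Qmat N M *ᵥ ψ with hu
  -- `|u|² ≤ N^{−d}|ψ|²`
  have hQ : u ⬝ᵥ u ≤ ((N : ℝ) ^ d)⁻¹ * (ψ ⬝ᵥ ψ) := by
    have h1 : u ⬝ᵥ u = ((N : ℝ) ^ d)⁻¹ * (ψ ⬝ᵥ (blockProj N M *ᵥ ψ)) := by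
      rw [hu]
      calc (Qmat N M *ᵥ ψ) ⬝ᵥ (Qmat N M *ᵥ ψ) = ((Qmat N M *ᵥ ψ) ᵥ* Qmat N M) ⬝ᵥ ψ :=
            Matrix.dotProduct_mulVec _ _ _
        _ = (((Qmat N M)ᵀ * Qmat N M) *ᵥ ψ) ⬝ᵥ ψ := by
            rw [← Matrix.mulVec_transpose, Matrix.mulVec_mulVec]
        _ = ((N : ℝ) ^ d)⁻¹ * (ψ ⬝ᵥ (blockProj N M *ᵥ ψ)) := by
            rw [transpose_Qmat_mul_Qmat, Matrix.smul_mulVec, smul_dotProduct, smul_eq_mul, dotProduct_comm]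
    rw [h1]
    exact mul_le_mul_of_nonneg_left (blockProj_form_le N M ψ) (inv_nonneg.mpr hNd.le)
  -- `m²|ψ|² ≤ ⟨ψ, Bψ⟩`
  have hB := lapF_coercive (fine N M) c m2 hc ψ
  -- the two-term minimum
  have hs : 0 ≤ (u - (a / (a + m2)) • φ) ⬝ᵥ (u - (a / (a + m2)) • φ) :=
    Finset.sum_nonneg fun i _ => mul_self_nonneg _
  have hexp : (u - (a / (a + m2)) • φ) ⬝ᵥ (u - (a / (a + m2)) • φ)
      = u ⬝ᵥ u - 2 * (a / (a + m2)) * (φ ⬝ᵥ u) + (a / (a + m2)) ^ 2 * (φ ⬝ᵥ φ) := by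
    simp only [dotProduct_sub, sub_dotProduct, dotProduct_smul, smul_dotProduct, smul_eq_mul, dotProduct_comm u φ]
    ring
  have hexp2 : (φ - u) ⬝ᵥ (φ - u) = φ ⬝ᵥ φ - 2 * (φ ⬝ᵥ u) + u ⬝ᵥ u := by
    simp only [dotProduct_sub, sub_dotProduct, dotProduct_comm u φ]
    ring
  have hγ : (a⁻¹ + m2⁻¹)⁻¹ = a * m2 / (a + m2) := by
    field_simp
    ring
  have ham : 0 < a + m2 := by positivity
  rw [hγ, hexp2]
  rw [hexp] at hs
  -- `m²|u|² ≤ N^{−d}⟨ψ, Bψ⟩`, and the scalar inequality `a(s − 2p + r) + m²r ≥ am²/(a+m²)·s`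
  have hE : m2 * (u ⬝ᵥ u) ≤ ((N : ℝ) ^ d)⁻¹ * (ψ ⬝ᵥ (lapF (fine N M) c m2 *ᵥ ψ)) := by
    calc m2 * (u ⬝ᵥ u) ≤ m2 * (((N : ℝ) ^ d)⁻¹ * (ψ ⬝ᵥ ψ)) := mul_le_mul_of_nonneg_left hQ hm.le
      _ = ((N : ℝ) ^ d)⁻¹ * (m2 * (ψ ⬝ᵥ ψ)) := by ring
      _ ≤ ((N : ℝ) ^ d)⁻¹ * (ψ ⬝ᵥ (lapF (fine N M) c m2 *ᵥ ψ)) := mul_le_mul_of_nonneg_left hB (inv_nonneg.mpr hNd.le)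
  have hid : a * (φ ⬝ᵥ φ - 2 * (φ ⬝ᵥ u) + u ⬝ᵥ u) + m2 * (u ⬝ᵥ u) - a * m2 / (a + m2) * (φ ⬝ᵥ φ)
      = (a + m2) * (u ⬝ᵥ u - 2 * (a / (a + m2)) * (φ ⬝ᵥ u) + (a / (a + m2)) ^ 2 * (φ ⬝ᵥ φ)) := by
    field_simp
    ring
  have := mul_nonneg ham.le hs
  linarith

end OneLevel

/-! ## §2 Two levels on the nested torus `Tor (fine N (fine L M))`: the objects -/

section TwoLevel

variable (N L : ℕ) [NeZero N] [NeZero L] (M : Fin d → ℕ) [hM : ∀ μ, NeZero (M μ)]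

/-- THE COMPOSITE BLOCK MEAN `Q_{k+1} = q ∘ Q_k` on the nested torus (`q = Qmat L M` one more blocking of the level-`k`
lattice `Tor (fine L M)`): mean over the composite blocks of `(NL)^d` sites. [cite: King1986, (2.10) p.653] -/
def Qmat₂ : Matrix (Tor M) (Tor (fine N (fine L M))) ℝ := Qmat L M * Qmat N (fine L M)

/-- THE COMPOSITE PROJECTOR `Q_{k+1}^*Q_{k+1} = (NL)^d·Q_{k+1}ᵀQ_{k+1}` (mean over the composite block, as a matrix on the
nested torus). [cite: King1986, (2.13) p.653 (the term `Q_k^*Q_k`), (4.36) p.674] -/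
def blockProj₂ : Matrix (Tor (fine N (fine L M))) (Tor (fine N (fine L M))) ℝ :=
  ((((N : ℝ) * L) ^ d)) • ((Qmat₂ N L M)ᵀ * Qmat₂ N L M)

/-- THE ONE-STEP FLUCTUATION COVARIANCE `C^{(k)} = (Δ^{(k)} + aL⁻²·Q*Q)⁻¹` on the level-`k` lattice `Tor (fine L M)`
((2.16) in level-`k` units: `a(L^{k+1}ε)^{−2} = aL⁻²`; `Δ^{(k)}` built with the level coefficient `a₁ = a_k`).  Literally
the body of the cell's `N15.KingModel.kingCov` (there `a₁ = aK a L k`, `c = N²`). [cite: King1986, (2.16) p.653, (4.32) p.674] -/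
def oneStepCov (a₁ a c m2 : ℝ) : Matrix (Tor (fine L M)) (Tor (fine L M)) ℝ :=
  (effLaplacian N (fine L M) a₁ c m2 + (a * ((L : ℝ) ^ 2)⁻¹) • blockProj L M)⁻¹

/-- THE NEXT CONSTRAINT COEFFICIENT in level-`k` units: `b = a·a₁∕(a + a₁L²)`, i.e. `b⁻¹ = a₁⁻¹ + L²a⁻¹` — the Gaussian
constant of «`k` steps then one more step»; at `a₁ = a_k` it is `a_{k+1}∕L²` (`nextLevelCoeff_aK`).
[cite: King1986, (2.13) p.653, (4.12) p.671] -/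
def nextLevelCoeff (a a₁ L : ℝ) : ℝ := a * a₁ / (a + a₁ * L ^ 2)

/-- **`b = a_{k+1}∕L²`**: with `a₁ = a_k = aK a L k` (`k ≥ 1`, `L > 1`), `nextLevelCoeff a a_k L = aK a L (k+1)∕L²` — by
King's composition identity `a_{1+k}⁻¹ = a_1⁻¹ + L⁻²a_k⁻¹` (`inv_aK_add`) and `a_1 = a`. [cite: King1986, (2.13) p.653] -/
theorem nextLevelCoeff_aK {a : ℝ} (ha : 0 < a) {L : ℝ} (hL : 1 < L) {k : ℕ} (hk : 1 ≤ k) :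
    nextLevelCoeff a (aK a L k) L = aK a L (k + 1) / L ^ 2 := by
  have hL0 : 0 < L := by linarith
  have hak : 0 < aK a L k := aK_pos ha hL hk
  have hak1 : 0 < aK a L (k + 1) := aK_pos ha hL (by omega)
  have h := inv_aK_add ha hL 1 k
  rw [aK_one hL, mul_one, add_comm 1 k] at h
  -- `h : (aK a L (k+1))⁻¹ = a⁻¹ + (L^2)⁻¹ * (aK a L k)⁻¹`
  have h' : aK a L (k + 1) = (a⁻¹ + (L ^ 2)⁻¹ * (aK a L k)⁻¹)⁻¹ := by rw [← h, inv_inv]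
  rw [h', nextLevelCoeff]
  field_simp
  ring

/-- THE LEVEL-`(k+1)` CONSTRAINED PROPAGATOR IN LEVEL-`k` UNITS on the nested torus: `N^d·(B + b·Q_{k+1}^*Q_{k+1})⁻¹`,
`b = nextLevelCoeff a a₁ L` — (2.13) with `k+1` for `k` (constraint `a_{k+1}(L^{k+1}ε)^{−2}Q^*_{k+1}Q_{k+1}`, `L^{k+1}ε = L`),
the covariance matrix of the fluctuation field constrained on the composite blocks. [cite: King1986, (2.13) p.653, (2.20) p.654] -/
def constrainedProp₂ (a₁ a c m2 : ℝ) : Matrix (Tor (fine N (fine L M))) (Tor (fine N (fine L M))) ℝ :=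
  ((N : ℝ) ^ d) • (lapF (fine N (fine L M)) c m2 + (nextLevelCoeff a a₁ L) • blockProj₂ N L M)⁻¹

/-! ## §3 The splitting theorem -/

/-- `Δ^{(k)} + aL⁻²Q*Q` is invertible (`Δ^{(k)}` coercive, `Q*Q ≥ 0`): `C^{(k)}` of (2.16) exists, for every `c ≥ 0`.
[cite: King1986, (2.16) p.653, (4.33) p.674] -/
theorem isUnit_effLaplacian_add_blockProj {a₁ a c m2 : ℝ} (ha₁ : 0 < a₁) (ha : 0 ≤ a) (hc : 0 ≤ c) (hm : 0 < m2) :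
    IsUnit (effLaplacian N (fine L M) a₁ c m2 + (a * ((L : ℝ) ^ 2)⁻¹) • blockProj L M) := by
  refine QGQInverse.isUnit_of_coercive (γ := (a₁⁻¹ + m2⁻¹)⁻¹) (by positivity) ?_
  intro φ
  have h1 := effLaplacian_coercive_of_nonneg N (fine L M) ha₁ hc hm φ
  have h2 : 0 ≤ φ ⬝ᵥ (blockProj L M *ᵥ φ) := blockProj_form_nonneg L M φ
  rw [Matrix.add_mulVec, dotProduct_add, Matrix.smul_mulVec, dotProduct_smul, smul_eq_mul]
  have h3 : 0 ≤ a * ((L : ℝ) ^ 2)⁻¹ * (φ ⬝ᵥ (blockProj L M *ᵥ φ)) := mul_nonneg (by positivity) h2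
  linarith

/-- **KING'S (2.17), ONE STEP: `G^ε_{k+1} = G^ε_k + ℋ_kC^{(k)}ℋ_kᵀ = G^ε_k + a_k²G^ε_kQ_k^*·C^{(k)}·Q_kG^ε_k`** — the
level-`(k+1)` block-constrained propagator (in level-`k` units) equals the level-`k` one plus the minimiser-dressed
one-step fluctuation covariance; EXACT, for every `a, a₁ > 0`, `c ≥ 0`, `m² > 0`, `N, L ≥ 1` and every torus.  (The
composition law `T_{a,L}∘T_{a₁,L^k} = T_{b·L²,L^{k+1}}` of the block-spin Gaussian read on covariances: the law of total
covariance `Cov ψ = E Cov(ψ|φ) + Cov E(ψ|φ)` with `E(ψ|φ) = ℋ_kφ`, `Cov(ψ|φ) = G^ε_k`, `Cov φ = C^{(k)}`; proved here by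
verifying the inverse.) [cite: King1986, (2.13)–(2.17) p.653, (2.18) p.654] -/
theorem constrainedProp₂_eq {a a₁ c m2 : ℝ} (ha : 0 < a) (ha₁ : 0 < a₁) (hc : 0 ≤ c) (hm : 0 < m2) :
    constrainedProp₂ N L M a₁ a c m2
      = constrainedProp N (fine L M) a₁ c m2
        + minimiserMat N (fine L M) a₁ c m2 * oneStepCov N L M a₁ a c m2 * (minimiserMat N (fine L M) a₁ c m2)ᵀ := by
  rw [transpose_minimiserMat]
  unfold constrainedProp₂ constrainedProp minimiserMat oneStepCov
  set A := fineOp N (fine L M) a₁ c m2 with hA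
  set Q := Qmat N (fine L M) with hQ
  set q := Qmat L M with hq
  set PL := blockProj L M with hPL
  set E := effLaplacian N (fine L M) a₁ c m2 with hE
  set β : ℝ := a * ((L : ℝ) ^ 2)⁻¹ with hβ
  set C := (E + β • PL)⁻¹ with hC
  set b := nextLevelCoeff a a₁ L with hb
  set T := lapF (fine N (fine L M)) c m2 + b • blockProj₂ N L M with hT
  set S := Q * A⁻¹ * Qᵀ with hS
  set κ : ℝ := a₁ ^ 2 * (N : ℝ) ^ d with hκ
  set R : Matrix (Tor (fine L M)) (Tor (fine L M)) ℝ :=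
    (b * ((N : ℝ) * L) ^ d) • (qᵀ * q) - (a₁ * (N : ℝ) ^ d) • (1 : Matrix (Tor (fine L M)) (Tor (fine L M)) ℝ) with hR
  have hN0 : (0 : ℝ) < N := by exact_mod_cast Nat.pos_of_ne_zero (NeZero.ne N)
  have hL0 : (0 : ℝ) < L := by exact_mod_cast Nat.pos_of_ne_zero (NeZero.ne L)
  have hNd : (0 : ℝ) < (N : ℝ) ^ d := pow_pos hN0 _
  have hLd : (0 : ℝ) < (L : ℝ) ^ d := pow_pos hL0 _
  -- (1) `Q*Q = N^d·QᵀQ` on the fine torus, `Q*Q = L^d·qᵀq` on the level-`k` lattice, `qqᵀ = L^{−d}`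
  have hPN : blockProj N (fine L M) = ((N : ℝ) ^ d) • (Qᵀ * Q) := by
    rw [hQ, transpose_Qmat_mul_Qmat, smul_smul, mul_inv_cancel₀ hNd.ne', one_smul]
  have hPLq : PL = ((L : ℝ) ^ d) • (qᵀ * q) := by
    rw [hPL, hq, transpose_Qmat_mul_Qmat, smul_smul, mul_inv_cancel₀ hLd.ne', one_smul]
  have hqq : q * qᵀ = (((L : ℝ) ^ d)⁻¹) • (1 : Matrix (Tor M) (Tor M) ℝ) := Qmat_mul_transpose_Qmat L M
  have hqqq : qᵀ * q * (qᵀ * q) = (((L : ℝ) ^ d)⁻¹) • (qᵀ * q) := by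
    rw [Matrix.mul_assoc, ← Matrix.mul_assoc q, hqq, Matrix.smul_mul, Matrix.one_mul, Matrix.mul_smul]
  -- (2) invertibility of `A₀` and of `Δ^{(k)} + aL⁻²Q*Q`
  have hAu : IsUnit A.det := (Matrix.isUnit_iff_isUnit_det _).mp (fineOp_isUnit N (fine L M) ha₁.le hc hm)
  have hAA : A * A⁻¹ = 1 := Matrix.mul_nonsing_inv A hAu
  have hCu := (Matrix.isUnit_iff_isUnit_det _).mp (isUnit_effLaplacian_add_blockProj N L M ha₁ ha.le hc hm)
  have hCC : (E + β • PL) * C = 1 := Matrix.mul_nonsing_inv _ hCu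
  -- (3) `Δ^{(k)} = a₁ − κ·S` and `T = A₀ + QᵀRQ`
  have hEdef : E = a₁ • (1 : Matrix (Tor (fine L M)) (Tor (fine L M)) ℝ) - κ • S := by
    rw [hE, hκ, hS, hQ, hA, effLaplacian]
  have hTdef : T = A + Qᵀ * R * Q := by
    rw [hT, hA, fineOp, hPN, hR, blockProj₂, Qmat₂, ← hq, ← hQ, Matrix.transpose_mul]
    simp only [Matrix.mul_sub, Matrix.sub_mul, Matrix.smul_mul, Matrix.mul_smul, Matrix.mul_one, smul_smul,
      Matrix.mul_assoc]
    abel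
  -- (4) the scalar heart: `κ·1 + a₁·R + β·R·Q*Q = 0` ⟸ `a₁bL² = a(a₁ − b)`
  have key2 : κ • (1 : Matrix (Tor (fine L M)) (Tor (fine L M)) ℝ) + a₁ • R + β • (R * PL) = 0 := by
    rw [hR, hPLq, Matrix.sub_mul, Matrix.smul_mul, Matrix.smul_mul, Matrix.mul_smul, Matrix.mul_smul,
      Matrix.one_mul, hqqq, smul_smul, smul_smul, smul_smul, smul_sub, smul_sub, smul_smul, smul_smul,
      smul_smul, smul_smul]
    have hcoef1 : κ - a₁ * (a₁ * (N : ℝ) ^ d) = 0 := by rw [hκ]; ring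
    have hcoef2 : a₁ * (b * ((N : ℝ) * L) ^ d)
        + (β * (b * ((N : ℝ) * L) ^ d * (L : ℝ) ^ d * ((L : ℝ) ^ d)⁻¹) - β * (a₁ * (N : ℝ) ^ d * (L : ℝ) ^ d)) = 0 := by
      rw [hβ, hb, nextLevelCoeff, mul_pow]
      field_simp
      ring
    calc κ • (1 : Matrix (Tor (fine L M)) (Tor (fine L M)) ℝ)
          + (((a₁ * (b * ((N : ℝ) * L) ^ d)) • (qᵀ * q)) - (a₁ * (a₁ * (N : ℝ) ^ d)) • 1)
          + (((β * (b * ((N : ℝ) * L) ^ d * (L : ℝ) ^ d * ((L : ℝ) ^ d)⁻¹)) • (qᵀ * q))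
              - (β * (a₁ * (N : ℝ) ^ d * (L : ℝ) ^ d)) • (qᵀ * q))
          = (κ - a₁ * (a₁ * (N : ℝ) ^ d)) • (1 : Matrix (Tor (fine L M)) (Tor (fine L M)) ℝ)
            + (a₁ * (b * ((N : ℝ) * L) ^ d)
                + (β * (b * ((N : ℝ) * L) ^ d * (L : ℝ) ^ d * ((L : ℝ) ^ d)⁻¹) - β * (a₁ * (N : ℝ) ^ d * (L : ℝ) ^ d)))
              • (qᵀ * q) := by
            rw [sub_smul, add_smul, sub_smul]
            abel
      _ = 0 := by rw [hcoef1, hcoef2, zero_smul, zero_smul, add_zero]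
  -- (5) `κ(1 + RS) + R(Δ^{(k)} + β·Q*Q) = 0`
  have key1 : κ • (1 + R * S) + R * (E + β • PL) = 0 := by
    rw [hEdef]
    simp only [Matrix.mul_add, Matrix.mul_sub, Matrix.mul_smul, Matrix.mul_one, smul_add]
    calc κ • (1 : Matrix (Tor (fine L M)) (Tor (fine L M)) ℝ) + κ • (R * S)
          + (a₁ • R - κ • (R * S) + β • (R * PL))
          = κ • 1 + a₁ • R + β • (R * PL) + (κ • (R * S) - κ • (R * S)) := by abel
      _ = 0 := by rw [key2, sub_self, add_zero]
  -- (6) multiply by `C = (Δ^{(k)} + β·Q*Q)⁻¹`: `R + κ(1 + RS)C = 0`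
  have key : R + κ • ((1 + R * S) * C) = 0 := by
    have h := congrArg (fun X => X * C) key1
    rwa [Matrix.add_mul, Matrix.zero_mul, Matrix.mul_assoc R (E + β • PL) C, hCC, Matrix.mul_one,
      Matrix.smul_mul, add_comm] at h
  -- (7) the candidate inverse works: `T·(A⁻¹ + κ·A⁻¹QᵀCQA⁻¹) = 1`
  have hW : T * (A⁻¹ + κ • (A⁻¹ * (Qᵀ * (C * (Q * A⁻¹))))) = 1 := by
    have e4 : Qᵀ * (R * (Q * A⁻¹)) + (κ • (Qᵀ * (C * (Q * A⁻¹))) + Qᵀ * (κ • (R * (S * (C * (Q * A⁻¹)))))) = 0 := by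
      rw [← Matrix.mul_smul, ← Matrix.mul_add, ← Matrix.mul_add]
      have h := congrArg (fun X => X * (Q * A⁻¹)) key
      simp only [Matrix.add_mul, Matrix.zero_mul, Matrix.smul_mul, Matrix.one_mul, Matrix.mul_assoc,
        smul_add] at h
      rw [h, Matrix.mul_zero]
    rw [hTdef, Matrix.add_mul, Matrix.mul_add, Matrix.mul_add, hAA]
    have e1 : A * (κ • (A⁻¹ * (Qᵀ * (C * (Q * A⁻¹))))) = κ • (Qᵀ * (C * (Q * A⁻¹))) := by
      rw [Matrix.mul_smul, ← Matrix.mul_assoc, hAA, Matrix.one_mul]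
    have e2 : Qᵀ * R * Q * A⁻¹ = Qᵀ * (R * (Q * A⁻¹)) := by simp only [Matrix.mul_assoc]
    have e3 : Qᵀ * R * Q * (κ • (A⁻¹ * (Qᵀ * (C * (Q * A⁻¹))))) = Qᵀ * (κ • (R * (S * (C * (Q * A⁻¹))))) := by
      rw [hS]; simp only [Matrix.mul_smul, Matrix.mul_assoc]
    rw [e1, e2, e3]
    calc (1 : Matrix (Tor (fine N (fine L M))) (Tor (fine N (fine L M))) ℝ) + κ • (Qᵀ * (C * (Q * A⁻¹)))
          + (Qᵀ * (R * (Q * A⁻¹)) + Qᵀ * (κ • (R * (S * (C * (Q * A⁻¹))))))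
          = 1 + (Qᵀ * (R * (Q * A⁻¹)) + (κ • (Qᵀ * (C * (Q * A⁻¹))) + Qᵀ * (κ • (R * (S * (C * (Q * A⁻¹))))))) := by
            abel
      _ = 1 := by rw [e4, add_zero]
  have hTinv : T⁻¹ = A⁻¹ + κ • (A⁻¹ * (Qᵀ * (C * (Q * A⁻¹)))) := Matrix.inv_eq_right_inv hW
  -- (8) assemble: `N^d·T⁻¹ = N^d·A⁻¹ + ℋCℋᵀ`
  rw [hTinv, smul_add, hκ]
  congr 1
  simp only [Matrix.smul_mul, Matrix.mul_smul, smul_smul, Matrix.mul_assoc]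
  congr 1
  ring

/-! ## §4 The kernel form: (4.42) ∕ «the obvious definition of `G^ε_{(j)}`» -/

/-- **`G^ε_{k+1}(x, y) − G^ε_k(x, y) = Σ_w (Σ_z ℋ_k(x, z)·C^{(k)}(z, w))·ℋ_k(y, w)`** — the slice `G^ε_{(k)} = G^ε_{k+1} −
G^ε_k` IS the minimiser-dressed one-step covariance, entrywise. [cite: King1986, (2.17) p.653, (4.42) p.675] -/
theorem constrainedProp₂_sub_apply {a a₁ c m2 : ℝ} (ha : 0 < a) (ha₁ : 0 < a₁) (hc : 0 ≤ c) (hm : 0 < m2)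
    (x y : Tor (fine N (fine L M))) :
    constrainedProp₂ N L M a₁ a c m2 x y - constrainedProp N (fine L M) a₁ c m2 x y
      = ∑ w, (∑ z, minimiserMat N (fine L M) a₁ c m2 x z * oneStepCov N L M a₁ a c m2 z w)
          * minimiserMat N (fine L M) a₁ c m2 y w := by
  rw [constrainedProp₂_eq N L M ha ha₁ hc hm, Matrix.add_apply, add_sub_cancel_left, Matrix.mul_apply]
  refine Finset.sum_congr rfl fun w _ => ?_
  rw [Matrix.mul_apply, Matrix.transpose_apply]

/-- The same with the minimiser KERNEL `ℋ_k(x, z) = minimiser … (δ_z)(x)` spelled as the cell's files spell it.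
[cite: King1986, (2.17) p.653, (4.42) p.675] -/
theorem constrainedProp₂_sub_apply_minimiser {a a₁ c m2 : ℝ} (ha : 0 < a) (ha₁ : 0 < a₁) (hc : 0 ≤ c)
    (hm : 0 < m2) (x y : Tor (fine N (fine L M))) :
    constrainedProp₂ N L M a₁ a c m2 x y - constrainedProp N (fine L M) a₁ c m2 x y
      = ∑ w, (∑ z, minimiser N (fine L M) a₁ c m2 (Pi.single z 1) x * oneStepCov N L M a₁ a c m2 z w)
          * minimiser N (fine L M) a₁ c m2 (Pi.single w 1) y := by
  simp only [constrainedProp₂_sub_apply N L M ha ha₁ hc hm, minimiserMat_apply]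

/-- The slice as a matrix factorisation: `G^ε_{(k)} := G^ε_{k+1} − G^ε_k = ℋ_k·C^{(k)}·ℋ_kᵀ` («the obvious definition of
`G^ε_{(j)}`» made a theorem). [cite: King1986, (2.17) p.653] -/
theorem constrainedProp₂_sub_eq {a a₁ c m2 : ℝ} (ha : 0 < a) (ha₁ : 0 < a₁) (hc : 0 ≤ c) (hm : 0 < m2) :
    constrainedProp₂ N L M a₁ a c m2 - constrainedProp N (fine L M) a₁ c m2
      = minimiserMat N (fine L M) a₁ c m2 * oneStepCov N L M a₁ a c m2 * (minimiserMat N (fine L M) a₁ c m2)ᵀ := by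
  rw [constrainedProp₂_eq N L M ha ha₁ hc hm, add_sub_cancel_left]

end TwoLevel

end Torus

end Literature.MathematicalPhysics.QuantumFieldTheory.King1986
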